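import Summits.KontsevichZagierPeriods.KontsevichZagierPeriods.Theorems.LinRedNormalFormArrangementNormalFormStubRebaseSimplePosOnePosQuadLocal
import Summits.KontsevichZagierPeriods.KontsevichZagierPeriods.Theorems.LinRedNormalFormArrangementNormalFormStubRebaseSimplePosOnePosQuadNorm
import Summits.KontsevichZagierPeriods.KontsevichZagierPeriods.Theorems.LinRedNormalFormArrangementNormalFormStubRebaseSimplePosOnePosQuadFarSep

/-!
# Stub `stub_rebaseSimplePosOnePos` (crux `ArrangementNormalForm`, line `janus-bands`) —
part `QuadFrame1`: the first frame of a localised flat cell and the far-factor separation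
(`B = 2`)

`B = 2` corner calculus. The inner piece of part `QuadLocal` (a parallel band over the product
cell `{x'-rows M₀} × (ylo, yhi)`, the `x'`-rows containing the square box of radius `r` around
the flat point `X`) is presented with CANONICAL rows (`RebasePos.canonRowsQ`: the lifted
`x'`-rows and the two `y`-walls) and moved by the affine base change of part `QuadNorm` with
`x₀ = X`, `A = (1 q; 0 1)`, `τ = 1` — flat point to the origin, pole plane to `y' = 0`, the
direction `(q, 1)` of the silent plane to the `x₂''`-axis (`RebasePos.good_inner_of_term`).
Then the far silent factors depending on `x₂''` (class `S`) are separated by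
`RebasePos.good_of_farSep` (part `QuadFarSep`): they do not vanish on the box when
`(|aⱼ| + |bⱼ|) r < |Lⱼ(X)|` (`hfar`), and the ratio condition holds when the resultants of the
`S`-pairs with distinct letters stay away from `0` on `|x₁''| ≤ (1 + |q|) r` (`hres`; `q`
generic and `r` small, chosen in part `QuadFinal`). What is left is the hypothesis `Hterm` on the
terminal data of the separation in this frame.

References: M. Kontsevich, D. Zagier, *Periods* (2001), §1.2, rules (1a), (1b), (2).
-/

noncomputable section

open Set MeasureTheory MvPolynomial
open Literature.NumberTheory.Transcendental Literature.ModelTheory.ExponentialFields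

namespace Summit.KontsevichZagierPeriods.ArrangementNormalForm.JanusBands

namespace RebasePos

open SeparatePos

section Frame1

variable {m m₀ : ℕ} (L : Fin m → (Fin 2 → ℚ) × ℚ) (e : Fin m → ℕ) (ℓ₁ ℓ₂ : (Fin 2 → ℚ) × ℚ)

/-- The lower `y`-wall `y − ylo(x') > 0` of a product cell (general position). -/
def wallLoGenQ (ylo : (Fin 2 → ℚ) × ℚ) : (Fin (2 + 1) → ℚ) × ℚ := (![-ylo.1 0, -ylo.1 1, 1], -ylo.2)

/-- The upper `y`-wall `yhi(x') − y > 0` of a product cell (general position). -/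
def wallHiGenQ (yhi : (Fin 2 → ℚ) × ℚ) : (Fin (2 + 1) → ℚ) × ℚ := (![yhi.1 0, yhi.1 1, -1], yhi.2)

/-- The canonical rows of a product cell: the lifted `x'`-rows, then the two `y`-walls. -/
def canonRowsQ (M₀ : Fin m₀ → (Fin 2 → ℚ) × ℚ) (ylo yhi : (Fin 2 → ℚ) × ℚ) : Fin (m₀ + 2) → (Fin (2 + 1) → ℚ) × ℚ :=
  Fin.append (fun j => liftX (M₀ j)) ![wallLoGenQ ylo, wallHiGenQ yhi]

/-- The canonical rows cut out the product cell. -/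
theorem canonRowsQ_iff (M₀ : Fin m₀ → (Fin 2 → ℚ) × ℚ) (ylo yhi : (Fin 2 → ℚ) × ℚ) (z : Fin (2 + 1 + 1) → ℝ) :
    (∀ j, 0 < affF 2 1 (canonRowsQ M₀ ylo yhi j) z) ↔
      ((∀ j, 0 < affB 2 1 (M₀ j) z) ∧ affB 2 1 ylo z < z (Fin.castAdd 1 (Fin.last 2)) ∧
        z (Fin.castAdd 1 (Fin.last 2)) < affB 2 1 yhi z) := by
  rw [canonRowsQ, Fin.forall_fin_add, Fin.forall_fin_two, jy_eq]
  simp only [Fin.append_left, Fin.append_right, Matrix.cons_val_zero, Matrix.cons_val_one, affF_liftX]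
  rw [wallLoGenQ, wallHiGenQ, affF_three, affF_three, affB_three, affB_three]
  simp
  exact fun _ => ⟨fun ⟨h1, h2⟩ => ⟨by linarith, by linarith⟩, fun ⟨h1, h2⟩ => ⟨by linarith, by linarith⟩⟩

/-- The first-frame matrix `(1 q; 0 1)`. -/
def matQ (q : ℚ) : Matrix (Fin 2) (Fin 2) ℚ := !![1, q; 0, 1]

/-- Its inverse `(1 −q; 0 1)`. -/
def matInvQ (q : ℚ) : Matrix (Fin 2) (Fin 2) ℚ := !![1, -q; 0, 1]

/-- `matQ q · matInvQ q = 1`. -/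
theorem matQ_mul (q : ℚ) : matQ q * matInvQ q = 1 := by
  ext i j; fin_cases i <;> fin_cases j <;> simp [matQ, matInvQ, Matrix.mul_apply, Fin.sum_univ_two]

/-- `matInvQ q · matQ q = 1`. -/
theorem matInvQ_mul (q : ℚ) : matInvQ q * matQ q = 1 := by
  ext i j; fin_cases i <;> fin_cases j <;> simp [matQ, matInvQ, Matrix.mul_apply, Fin.sum_univ_two]

/-- The silent factors in the first frame. -/
def NLQ (X : Fin 2 → ℚ) (q : ℚ) (L : Fin m → (Fin 2 → ℚ) × ℚ) : Fin m → (Fin 2 → ℚ) × ℚ :=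
  fun j => normLQ X (matQ q) (L j)

/-- In the first frame a point of the box has `|x₁''| ≤ (1 + |q|) r` and `|x₂''| ≤ r`. -/
theorem frame1_box_bounds (X : Fin 2 → ℚ) (q r : ℚ) (w : Fin (2 + 1 + 1) → ℝ)
    (h0 : |normMapQ X (matQ q) 1 ℓ₂ w 0 - X 0| < r) (h1 : |normMapQ X (matQ q) 1 ℓ₂ w 1 - X 1| < r) :
    |w 0| ≤ (1 + |(q : ℝ)|) * r ∧ |w 1| ≤ r := by
  rw [normMapQ_zero] at h0
  rw [normMapQ_one] at h1
  simp only [matQ, Matrix.of_apply, Matrix.cons_val', Matrix.cons_val_zero, Matrix.cons_val_one, Matrix.empty_val',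
    Matrix.cons_val_fin_one, Rat.cast_one, one_mul, Rat.cast_zero, zero_mul, add_zero] at h0 h1
  have e0 : (X 0 : ℝ) + w 0 + (q : ℝ) * w 1 - X 0 = w 0 + q * w 1 := by ring
  have e1 : (X 1 : ℝ) + w 1 - X 1 = w 1 := by ring
  rw [e0] at h0
  rw [e1] at h1
  refine ⟨?_, h1.le⟩
  have hw0 : w 0 = (w 0 + q * w 1) - q * w 1 := by ring
  rw [hw0]
  refine (abs_sub _ _).trans ?_
  rw [abs_mul]
  nlinarith [abs_nonneg (q : ℝ), abs_nonneg (w 1), h0.le, h1.le]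

/-- **The inner piece from the terminal data of the far-factor separation** (`B = 2`). The inner
piece of `good_quadCell_of_inner` (rows `M` with `hsec` over the `x'`-rows `M₀`, which contain
the four box rows of radius `r` around `X`: `hbox`), moved to the first frame
(`x' = X + (1 q; 0 1) x''`, `y = ℓ₂(x') + y'`), with the far factors depending on `x₂''`
separated: `[t] ∈ closure (GG 2 2 1)` modulo `KZ.relations` as soon as (`Hterm`) so is every
terminal datum. Side conditions: the far factors do not vanish on the box (`hfar`) and the
resultants of `S`-pairs with distinct letters dominate on the box (`hres`). -/
theorem good_inner_of_term (t : KZ.IntegralRep (2 + 1 + 1)) {m' : ℕ} (M : Fin m' → (Fin (2 + 1) → ℚ) × ℚ)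
    (M₀ : Fin m₀ → (Fin 2 → ℚ) × ℚ) (ylo yhi : (Fin 2 → ℚ) × ℚ) (p : MvPolynomial (Fin 2) ℚ)
    (u v : (Fin (2 + 1) → ℚ) × ℚ) (X : Fin 2 → ℚ) (q r : ℚ) (hr : 0 < r) (hbd : Bornology.IsBounded t.domain)
    (hdom : t.domain = gDom 2 1 m' M (fun _ => Sum.inr u) (fun _ => Sum.inr v))
    (hint : EqOn t.integrand (glit 2 1 p L e ℓ₁ ℓ₂ 0 1 (fun _ => some 0)) t.domain)
    (hsec : ∀ z : Fin (2 + 1 + 1) → ℝ, (∀ j, 0 < affF 2 1 (M j) z) ↔ ((∀ j, 0 < affB 2 1 (M₀ j) z) ∧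
      affB 2 1 ylo z < z (Fin.castAdd 1 (Fin.last 2)) ∧ z (Fin.castAdd 1 (Fin.last 2)) < affB 2 1 yhi z))
    (hbox : ∀ z : Fin (2 + 1 + 1) → ℝ, (∀ j, 0 < affB 2 1 (M₀ j) z) → |z 0 - X 0| < r ∧ |z 1 - X 1| < r)
    (hfar : ∀ j, e j ≠ 0 → (NLQ X q L j).2 ≠ 0 →
      ∀ z : Fin (2 + 1 + 1) → ℝ, |z 0 - X 0| < r → |z 1 - X 1| < r → affB 2 1 (L j) z ≠ 0)
    (hres : ∀ j j', e j ≠ 0 → e j' ≠ 0 → (NLQ X q L j).1 1 ≠ 0 → (NLQ X q L j).2 ≠ 0 → (NLQ X q L j').1 1 ≠ 0 →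
      (NLQ X q L j').2 ≠ 0 → sepLamQ (NLQ X q L) j ≠ sepLamQ (NLQ X q L) j' →
      ∃ c : ℝ, 0 < c ∧ ∀ x : ℝ, |x| ≤ (1 + |(q : ℝ)|) * r →
        c ≤ |((sepLamQ (NLQ X q L) j).1 0 - (sepLamQ (NLQ X q L) j').1 0 : ℝ) * x +
          ((sepLamQ (NLQ X q L) j).2 - (sepLamQ (NLQ X q L) j').2 : ℝ)|)
    (Hterm : ∀ (n : ℕ) (L' : Fin n → (Fin 2 → ℚ) × ℚ) (e' : Fin n → ℕ) (d' : Fin m → ℕ) (s' : KZ.IntegralRep (2 + 1 + 1)),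
      Bornology.IsBounded s'.domain →
      s'.domain = gDom 2 1 (m₀ + 2) (fun j => normFQ X (matQ q) 1 ℓ₂ (canonRowsQ M₀ ylo yhi j))
        (fun _ => Sum.inr (normFQ X (matQ q) 1 ℓ₂ u)) (fun _ => Sum.inr (normFQ X (matQ q) 1 ℓ₂ v)) →
      EqOn s'.integrand (glit 2 1 (MvPolynomial.C (sepCQ (NLQ X q L) e) * normPQ X (matQ q) 1 p)
        (termLsQ L' (NLQ X q L)) (termEsQ L' e' d') ℓ₁ 0 0 1 (fun _ => some 0)) s'.domain →
      (∀ i, (L' i).1 1 = 0 ∨ L' i = poleQ) →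
      (∀ j j', ((NLQ X q L j).1 1 ≠ 0 ∧ (NLQ X q L j).2 ≠ 0) → ((NLQ X q L j').1 1 ≠ 0 ∧ (NLQ X q L j').2 ≠ 0) →
        d' j ≠ 0 → d' j' ≠ 0 → sepLamQ (NLQ X q L) j = sepLamQ (NLQ X q L) j') →
      ∃ c ∈ AddSubgroup.closure (GGset 2 2 1), KZ.of s' - c ∈ KZ.relations) :
    ∃ c ∈ AddSubgroup.closure (GGset 2 2 1), KZ.of t - c ∈ KZ.relations := by
  classical
  -- canonical rows
  have hdomc : t.domain = gDom 2 1 (m₀ + 2) (canonRowsQ M₀ ylo yhi) (fun _ => Sum.inr u) (fun _ => Sum.inr v) := by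
    rw [hdom]
    ext z
    rw [mem_gDom_one, mem_gDom_one, hsec, canonRowsQ_iff]
  -- the first frame
  obtain ⟨s₁, hbd₁, hdom₁, hint₁, hmem₁, hrel₁⟩ := quadNormalize X (matQ q) (matInvQ q) 1 ℓ₂ (matQ_mul q)
    (matInvQ_mul q) (by norm_num) t _ L e p ℓ₁ u v hbd hdomc hint
  suffices h₁ : ∃ c ∈ AddSubgroup.closure (GGset 2 2 1), KZ.of s₁ - c ∈ KZ.relations by
    obtain ⟨c, hc, hc'⟩ := h₁
    exact ⟨c, hc, by have := add_mem hrel₁ hc'; rwa [sub_add_sub_cancel] at this⟩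
  -- points of the first frame domain map into the box
  have hbox₁ : ∀ w ∈ s₁.domain, |normMapQ X (matQ q) 1 ℓ₂ w 0 - X 0| < r ∧ |normMapQ X (matQ q) 1 ℓ₂ w 1 - X 1| < r := by
    intro w hw
    have hz := (hmem₁ w).1 hw
    rw [hdomc, mem_gDom_one, canonRowsQ_iff] at hz
    exact hbox _ hz.1.1
  -- a bound of the new distinguished coordinate on the domain
  obtain ⟨B₁, hB₁⟩ : ∃ B₁ : ℝ, ∀ w ∈ s₁.domain, |w 1| ≤ B₁ := by
    obtain ⟨C, hC⟩ := isBounded_iff_forall_norm_le.mp hbd₁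
    exact ⟨C, fun w hw => by have := norm_le_pi_norm w 1; rw [Real.norm_eq_abs] at this; exact this.trans (hC w hw)⟩
  refine good_of_farSep (NLQ X q L) e ℓ₁ s₁ _ (normPQ X (matQ q) 1 p) _ _ hbd₁ hdom₁ hint₁
    (fun j => (NLQ X q L j).1 1 ≠ 0 ∧ (NLQ X q L j).2 ≠ 0) (fun j hj => hj.1) ?_ ?_
    (fun n L' e' d' s' hbd' hdom' hint' hPL hall => Hterm n L' e' d' s' hbd' hdom' hint' hPL hall)
  · -- the far factors do not vanish on the domain
    intro j hj hej w hw
    obtain ⟨h0, h1⟩ := hbox₁ w hw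
    have h := hfar j hej hj.2 _ h0 h1
    rwa [← affB_normLQ X (matQ q) 1 ℓ₂] at h
  · -- the ratio condition from the resultant bound
    intro j j' hj hj' hej hej' hne
    obtain ⟨c, hc, hcx⟩ := hres j j' hej hej' hj.1 hj.2 hj'.1 hj'.2 hne
    set C₀ : ℝ := B₁ + (|((sepLamQ (NLQ X q L) j').1 0 : ℝ)| * ((1 + |(q : ℝ)|) * r) + |((sepLamQ (NLQ X q L) j').2 : ℝ)|)
      with hC₀
    refine ⟨C₀ / c, fun w hw => ?_⟩
    obtain ⟨h0, h1⟩ := hbox₁ w hw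
    obtain ⟨hw0, -⟩ := frame1_box_bounds ℓ₂ X q r w h0 h1
    have hlam : ∀ i, affB 2 1 (sepLamQ (NLQ X q L) i) w =
        ((sepLamQ (NLQ X q L) i).1 0 : ℝ) * w 0 + ((sepLamQ (NLQ X q L) i).2 : ℝ) := fun i => by
      rw [affB_three, sepLamQ]; simp
    have hresw : c ≤ |affB 2 1 (sepLamQ (NLQ X q L) j) w - affB 2 1 (sepLamQ (NLQ X q L) j') w| := by
      rw [hlam, hlam]
      have h := hcx (w 0) hw0
      rw [show ((sepLamQ (NLQ X q L) j).1 0 : ℝ) * w 0 + ((sepLamQ (NLQ X q L) j).2 : ℝ) -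
          (((sepLamQ (NLQ X q L) j').1 0 : ℝ) * w 0 + ((sepLamQ (NLQ X q L) j').2 : ℝ)) =
          (((sepLamQ (NLQ X q L) j).1 0 : ℝ) - ((sepLamQ (NLQ X q L) j').1 0 : ℝ)) * w 0 +
            (((sepLamQ (NLQ X q L) j).2 : ℝ) - ((sepLamQ (NLQ X q L) j').2 : ℝ)) by ring]
      exact h
    have hnum : |w 1 - affB 2 1 (sepLamQ (NLQ X q L) j') w| ≤ C₀ := by
      rw [hlam]
      refine (abs_sub _ _).trans ?_
      have e1 : |((sepLamQ (NLQ X q L) j').1 0 : ℝ) * w 0| ≤ |((sepLamQ (NLQ X q L) j').1 0 : ℝ)| * ((1 + |(q : ℝ)|) * r) := by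
        rw [abs_mul]; exact mul_le_mul_of_nonneg_left hw0 (abs_nonneg _)
      have e2 := abs_add_le (((sepLamQ (NLQ X q L) j').1 0 : ℝ) * w 0) ((sepLamQ (NLQ X q L) j').2 : ℝ)
      have e3 := hB₁ w hw
      rw [hC₀]
      linarith
    rw [div_mul_eq_mul_div, le_div_iff₀ hc]
    calc |w 1 - affB 2 1 (sepLamQ (NLQ X q L) j') w| * c ≤ C₀ * c := mul_le_mul_of_nonneg_right hnum hc.le
      _ ≤ C₀ * |affB 2 1 (sepLamQ (NLQ X q L) j) w - affB 2 1 (sepLamQ (NLQ X q L) j') w| :=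
          mul_le_mul_of_nonneg_left hresw (by
            rw [hC₀]
            have := hB₁ w hw
            have : 0 ≤ B₁ := (abs_nonneg _).trans this
            have hr' : (0 : ℝ) ≤ r := by exact_mod_cast hr.le
            positivity)

end Frame1

end RebasePos

/-- **Registered part of `stub_rebaseSimplePosOnePos` (line `janus-bands`, `B = 2` corner
calculus): the canonical rows of a product cell.** The lifted `x'`-rows followed by the two
`y`-walls `y − ylo(x') > 0`, `yhi(x') − y > 0` (`RebasePos.canonRowsQ`) cut out exactly the
product cell `{x'-rows} × (ylo, yhi)`; this re-presents the domain of a product cell with rows of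
known shape before the base changes of the corner calculus. -/
theorem rebaseSimplePos_canonRowsQ (m₀ : ℕ) (M₀ : Fin m₀ → (Fin 2 → ℚ) × ℚ) (ylo yhi : (Fin 2 → ℚ) × ℚ) (z : Fin (2 + 1 + 1) → ℝ) : (∀ j, 0 < SeparatePos.affF 2 1 (RebasePos.canonRowsQ M₀ ylo yhi j) z) ↔ ((∀ j, 0 < SeparatePos.affB 2 1 (M₀ j) z) ∧ SeparatePos.affB 2 1 ylo z < z (Fin.castAdd 1 (Fin.last 2)) ∧ z (Fin.castAdd 1 (Fin.last 2)) < SeparatePos.affB 2 1 yhi z) :=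
  RebasePos.canonRowsQ_iff M₀ ylo yhi z

end Summit.KontsevichZagierPeriods.ArrangementNormalForm.JanusBands
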